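import Literature.NumberTheory.EllipticCurves.ModularSymbolsProofs
import Literature.NumberTheory.EllipticCurves.ModularSymbolsManinGeneration
import Literature.NumberTheory.EllipticCurves.EichlerShimuraPeriodsGamma1
import HarnessLib

/-!
# Ray symbols `{∞, r}_G = 2π∫₀^∞ G(r+it) dt` of a weight-`2` cusp form on `Γ₁(L)`: integrability at
# every rational cusp and Manin's continued-fraction trick — the values lie in a finitely generated
# `ℤ`-module (no Manin–Drinfeld theorem, no Hecke operators)

Cell `pub/bsd-wall` (D-0145 line `route-BirchSwinnertonDyer-CyclotomicUntwist`), seat `bsd-line-cycu-p3`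
(prover seat 3/3, gen 9). THEOREMS ONLY (no definition, no named fact, no `sorry`); helper toward the crux
child C1 = stmt-BirchSwinnertonDyer-27548 (`PSUntwistedLFunctionAtThree`): it discharges, for EVERY cusp
form `G ∈ S₂(Γ₁(L))`, the two hypotheses on the `α`-stabilised untwist used by this seat's
`CyclotomicUntwistStabilisedTwistSymbol` / `CyclotomicUntwistF1OfLattice` — ray integrability (`hGint`) and
«the ray symbols take values in a finitely generated `ℤ`-submodule of `ℂ`» (the lattice clause). BSD is
not proved by this file; no crux and no child of the route is proved by it.

The tree's `ModularSymbolsProofs` proves all of this for `f ∈ S₂(Γ₀(N))` (`modularSymbol f r`); the weight-`2`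
symbol `{∞, r}` is typed there for `Γ₀(N)` only, so for `Γ₁(L)` we carry the ray integral as an explicit
expression / hypothesis-equation (`ΨG`, `hΨG`), and re-run the (level-free) analysis for a general
cuspidal `q`-series function `φ` (`IsCuspFunction`, e.g. `⇑G ∣[2] g`, `isCuspFunction_slash_gamma1`):

* §1 `jacobian_smul_ray'`, `integrableOn_raySymbol_integrand_smul`, `raySymbol_smul_infty` — for cusp
  functions `φ` and `φ ∣[2] g` (`g ∈ SL(2, ℤ)`, `c ≠ 0`): `t ↦ φ(a/c + it)` is integrable on `(0, ∞)` and
  `2π∫₀^∞ φ(a/c + it) dt = V_φ(gτ) − V_{φ|g}(τ)` (`γ` maps the ray above `γ⁻¹∞` onto the ray above `γ∞`;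
  Manin 1972, Prop. 1.4, §1.6; the proofs are those of `modularSymbol_smul_infty`, verbatim for `φ`).
* §2 `integrableOn_raySymbol_integrand` — for `G ∈ S₂(Γ₁(L))` and every `r ∈ ℚ` (`r = δ_r ∞`,
  `cuspMatrix`); `raySymbol_eq` — `{∞, g∞}_G = V_G(gτ) − V_{G|g}(τ)`;
  `raySymbol_sub_raySymbol_eq` — the UNIMODULAR STEP `{∞, g∞}_G − {∞, gS∞}_G = −{∞, 0}_{G|g}`.
* §3 `exists_fg_forall_raySymbol_mem` — **MANIN'S TRICK**: the unimodular symbols `{∞,0}_{G|g}` depend only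
  on the coset `Γ₁(L)g` (`G ∣[2] γ = G`), of which there are finitely many (`Γ₁(L)` has finite index), so
  they span a finitely generated `ℤ`-module `Λ_G`; by strong induction on the denominator along the
  Euclidean algorithm (`exists_unimodular_step`) every `{∞, a/c}_G` lies in `Λ_G`.

References: [cite: Manin1972, Prop. 1.4, §1.5–§1.6] · [cite: CremonaAlgorithms1997, §2.1 (Prop. 2.1.1), §2.10].
-/

noncomputable section

open scoped MatrixGroups ModularForm Topology

open CongruenceSubgroup Complex MeasureTheory Set Filter Function
open UpperHalfPlane hiding I
open Literature.NumberTheory.EllipticCurves Literature.NumberTheory.EllipticCurves.ModularForms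

-- single-conjunct summit: `Summit.BirchSwinnertonDyer.BirchSwinnertonDyer.…` repeats the name by design
set_option linter.dupNamespace false
set_option autoImplicit false

namespace Summit.BirchSwinnertonDyer.BirchSwinnertonDyer.Theorems.PSGamma1RaySymbol

/-! ### §1 Ray integrals of a cuspidal `q`-series function at a cusp `γ∞` -/

section CuspFunction

variable {h₁ h₂ : ℝ} {φ : ℍ → ℂ} (g : SL(2, ℤ))

/-- **Weight-`2` transformation along the ray** (as `jacobian_smul_ray`, for a bare function `φ`): with
`t = 1/(c²u)`, `φ(a/c + it) · |dt/du| = -(φ ∣[2] γ)(-d/c + iu)`. [cite: CremonaAlgorithms1997, §2.10] -/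
theorem jacobian_smul_ray' (hc : (g 1 0 : ℤ) ≠ 0) {u : ℝ} (hu : 0 < u) :
    |(-(1 / (((g 1 0 : ℤ) : ℝ) ^ 2 * u ^ 2)) : ℝ)| •
      φ (ofComplex (((g 0 0 : ℤ) : ℂ) / ((g 1 0 : ℤ) : ℂ) +
        ((1 / (((g 1 0 : ℤ) : ℝ) ^ 2 * u) : ℝ) : ℂ) * I)) =
      -(φ ∣[(2 : ℤ)] g) (ofComplex (-((g 1 1 : ℤ) : ℂ) / ((g 1 0 : ℤ) : ℂ) + u * I)) := by
  have hc' : ((g 1 0 : ℤ) : ℂ) ≠ 0 := by exact_mod_cast hc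
  have hcR : ((g 1 0 : ℤ) : ℝ) ≠ 0 := by exact_mod_cast hc
  have hu' : (u : ℂ) ≠ 0 := by exact_mod_cast hu.ne'
  have him : 0 < (-((g 1 1 : ℤ) : ℂ) / ((g 1 0 : ℤ) : ℂ) + u * I).im := by
    simpa [div_im] using hu
  rw [ModularForm.SL_slash_apply, smul_ofComplex g him, moebius_ray g hc hu.ne',
    denom_ofComplex g him, denom_ray g hc u, abs_of_neg (by
      have : 0 < 1 / (((g 1 0 : ℤ) : ℝ) ^ 2 * u ^ 2) := by positivity
      linarith), Complex.real_smul]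
  push_cast
  rw [zpow_neg, zpow_two]
  field_simp
  rw [I_sq]
  ring

/-- **Integrability of the ray integrand at the cusp `γ∞`** for cusp functions `φ`, `φ ∣[2] γ` (`c ≠ 0`):
near `t = 0` substitute `t = 1/(c²u)` (as `integrableOn_modularSymbol_integrand_smul`).
[cite: Manin1972, §1.5] [cite: CremonaAlgorithms1997, §2.10] -/
theorem integrableOn_raySymbol_integrand_smul (hφ : IsCuspFunction h₁ φ) (hψ : IsCuspFunction h₂ (φ ∣[(2 : ℤ)] g))
    (hc : (g 1 0 : ℤ) ≠ 0) :
    IntegrableOn (fun t : ℝ ↦ φ (ofComplex (((g 0 0 : ℤ) : ℂ) / ((g 1 0 : ℤ) : ℂ) + t * I))) (Ioi 0) := by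
  have hCR : ((g 1 0 : ℤ) : ℝ) ≠ 0 := by exact_mod_cast hc
  have hCa : (0 : ℝ) < |((g 1 0 : ℤ) : ℝ)| := abs_pos.mpr hCR
  have hT : (0 : ℝ) < 1 / |((g 1 0 : ℤ) : ℝ)| := by positivity
  have htail : IntegrableOn
      (fun t : ℝ ↦ φ (ofComplex (((g 0 0 : ℤ) : ℂ) / ((g 1 0 : ℤ) : ℂ) + t * I)))
      (Ioi (1 / |((g 1 0 : ℤ) : ℝ)|)) := by
    rw [integrableOn_Ioi_iff_integrableOn_Ioi_add]
    have := hφ.integrableOn_ray (g • ofComplex (rayBase g))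
    rw [coe_smul_rayBase g hc] at this
    refine this.congr_fun (fun t _ ↦ ?_) measurableSet_Ioi
    dsimp only
    congr 2
    push_cast
    ring
  have hhead : IntegrableOn
      (fun t : ℝ ↦ φ (ofComplex (((g 0 0 : ℤ) : ℂ) / ((g 1 0 : ℤ) : ℂ) + t * I)))
      (Ioo 0 (1 / |((g 1 0 : ℤ) : ℝ)|)) := by
    rw [← image_inv_ray hCR, integrableOn_image_iff_integrableOn_abs_deriv_smul
      measurableSet_Ioi (fun u hu ↦ (hasDerivAt_inv_ray hCR
        (lt_trans hT hu).ne').hasDerivWithinAt) (injOn_inv_ray hCR _)]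
    have H : IntegrableOn (fun u : ℝ ↦ (φ ∣[(2 : ℤ)] g)
        (ofComplex (-((g 1 1 : ℤ) : ℂ) / ((g 1 0 : ℤ) : ℂ) + u * I)))
        (Ioi (1 / |((g 1 0 : ℤ) : ℝ)|)) := by
      rw [integrableOn_Ioi_iff_integrableOn_Ioi_add]
      have := hψ.integrableOn_ray (ofComplex (rayBase g))
      rw [coe_ofComplex_rayBase g hc] at this
      refine this.congr_fun (fun t _ ↦ ?_) measurableSet_Ioi
      dsimp only
      rw [rayBase]
      push_cast
      ring_nf
    refine H.neg.congr_fun (fun u hu ↦ ?_) measurableSet_Ioi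
    simp only [Pi.neg_apply]
    exact (jacobian_smul_ray' g hc (lt_trans hT hu)).symm
  rw [← Ioc_union_Ioi_eq_Ioi hT.le]
  exact ((integrableOn_Ioc_iff_integrableOn_Ioo).mpr hhead).union htail

/-- **`{∞, γ∞}_φ = V_φ(γτ) − V_{φ|γ}(τ)`** for cusp functions `φ`, `φ ∣[2] γ`, `c ≠ 0`, and every `τ ∈ ℍ`
(as `modularSymbol_smul_infty`). [cite: Manin1972, Prop. 1.4] [cite: CremonaAlgorithms1997, §2.1 (Prop. 2.1.1)] -/
theorem raySymbol_smul_infty (hφ : IsCuspFunction h₁ φ) (hψ : IsCuspFunction h₂ (φ ∣[(2 : ℤ)] g))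
    (hc : (g 1 0 : ℤ) ≠ 0) (τ : ℍ) :
    2 * Real.pi * ∫ t in Ioi (0 : ℝ), φ (ofComplex (((g 0 0 : ℤ) : ℂ) / ((g 1 0 : ℤ) : ℂ) + t * I)) =
      verticalIntegral φ (g • τ) - verticalIntegral (φ ∣[(2 : ℤ)] g) τ := by
  have hCR : ((g 1 0 : ℤ) : ℝ) ≠ 0 := by exact_mod_cast hc
  have hCa : (0 : ℝ) < |((g 1 0 : ℤ) : ℝ)| := abs_pos.mpr hCR
  have hT : (0 : ℝ) < 1 / |((g 1 0 : ℤ) : ℝ)| := by positivity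
  rw [verticalIntegral_smul_sub_eq g hφ hψ τ (ofComplex (rayBase g))]
  set F : ℝ → ℂ := fun t ↦ φ (ofComplex (((g 0 0 : ℤ) : ℂ) / ((g 1 0 : ℤ) : ℂ) + t * I)) with hF
  have hFi := integrableOn_raySymbol_integrand_smul g hφ hψ hc
  have htail : ∫ t in Ioi (1 / |((g 1 0 : ℤ) : ℝ)|), F t =
      ∫ t in Ioi (0 : ℝ), φ (ofComplex (((g • ofComplex (rayBase g) : ℍ) : ℂ) + t * I)) := by
    rw [integral_Ioi_eq_integral_Ioi_add]
    refine setIntegral_congr_fun measurableSet_Ioi fun t _ ↦ ?_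
    simp only [hF, coe_smul_rayBase g hc]
    congr 2
    push_cast
    ring
  have hhead : ∫ t in Ioo 0 (1 / |((g 1 0 : ℤ) : ℝ)|), F t =
      -∫ t in Ioi (0 : ℝ), (φ ∣[(2 : ℤ)] g)
        (ofComplex (((ofComplex (rayBase g) : ℍ) : ℂ) + t * I)) := by
    rw [← image_inv_ray hCR, integral_image_eq_integral_abs_deriv_smul
      measurableSet_Ioi (fun u hu ↦ (hasDerivAt_inv_ray hCR
        (lt_trans hT hu).ne').hasDerivWithinAt) (injOn_inv_ray hCR _),
      ← integral_neg, integral_Ioi_eq_integral_Ioi_add]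
    refine setIntegral_congr_fun measurableSet_Ioi fun u hu ↦ ?_
    rw [hF, jacobian_smul_ray' g hc (add_pos hu hT), coe_ofComplex_rayBase g hc]
    congr 3
    rw [rayBase]
    push_cast
    ring_nf
  have hsplit : ∫ t in Ioi (0 : ℝ), F t =
      (∫ t in Ioo 0 (1 / |((g 1 0 : ℤ) : ℝ)|), F t) + ∫ t in Ioi (1 / |((g 1 0 : ℤ) : ℝ)|), F t := by
    rw [← Ioc_union_Ioi_eq_Ioi hT.le, setIntegral_union (Ioc_disjoint_Ioi le_rfl)
      measurableSet_Ioi (hFi.mono_set Ioc_subset_Ioi_self) (hFi.mono_set (Ioi_subset_Ioi hT.le)),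
      integral_Ioc_eq_integral_Ioo]
  simp only [verticalIntegral]
  rw [hsplit, hhead, htail]
  ring

end CuspFunction

/-! ### §2 Cusp forms on `Γ₁(L)`: invariance, integrability at every rational, the unimodular step -/

section Gamma1

variable {L : ℕ} [NeZero L] (G : CuspForm (Gamma1 L) 2)

omit [NeZero L] in
/-- For `γ ∈ Γ₁(L)`, `G ∣[2] γ = G`. [folklore] -/
theorem slash_Gamma1 {γ : SL(2, ℤ)} (hγ : γ ∈ Gamma1 L) : ⇑G ∣[(2 : ℤ)] γ = ⇑G := by
  rw [ModularForm.SL_slash]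
  exact SlashInvariantForm.slash_action_eqn G _ (Subgroup.mem_map_of_mem (Matrix.SpecialLinearGroup.mapGL ℝ) hγ)

omit [NeZero L] in
/-- `G ∣[2] (γ g) = G ∣[2] g` for `γ ∈ Γ₁(L)`. [folklore] -/
theorem slash_mul_of_mem {γ : SL(2, ℤ)} (hγ : γ ∈ Gamma1 L) (g : SL(2, ℤ)) :
    ⇑G ∣[(2 : ℤ)] (γ * g) = ⇑G ∣[(2 : ℤ)] g := by
  rw [SlashAction.slash_mul, slash_Gamma1 G hγ]

/-- **`{∞, γ∞}_G = V_G(γτ) − V_{G|γ}(τ)`** for `G ∈ S₂(Γ₁(L))`, `γ ∈ SL(2, ℤ)` with `c ≠ 0`.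
[cite: Manin1972, Prop. 1.4] -/
theorem raySymbol_eq (g : SL(2, ℤ)) (hc : (g 1 0 : ℤ) ≠ 0) (τ : ℍ) :
    2 * Real.pi * ∫ t in Ioi (0 : ℝ), G (ofComplex (((g 0 0 : ℤ) : ℂ) / ((g 1 0 : ℤ) : ℂ) + t * I)) =
      verticalIntegral ⇑G (g • τ) - verticalIntegral (⇑G ∣[(2 : ℤ)] g) τ :=
  raySymbol_smul_infty g (isCuspFunction_one_gamma1 G) (isCuspFunction_slash_gamma1 G g) hc τ

/-- **Ray integrability at every rational cusp** for `G ∈ S₂(Γ₁(L))`: `t ↦ G(r + it)` is integrable on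
`(0, ∞)` (`r = δ_r ∞`, `cuspMatrix`). [cite: Manin1972, §1.5] [cite: CremonaAlgorithms1997, §2.10] -/
theorem integrableOn_raySymbol_integrand (r : ℚ) :
    IntegrableOn (fun t : ℝ ↦ G (ofComplex ((r : ℂ) + t * I))) (Ioi 0) := by
  have h := integrableOn_raySymbol_integrand_smul (cuspMatrix r) (isCuspFunction_one_gamma1 G)
    (isCuspFunction_slash_gamma1 G (cuspMatrix r)) (cuspMatrix_apply_one_zero_ne_zero r)
  have hr : (((cuspMatrix r 0 0 : ℤ) : ℂ) / ((cuspMatrix r 1 0 : ℤ) : ℂ)) = (r : ℂ) := by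
    have := cuspMatrix_div r
    exact_mod_cast this
  simpa only [hr] using h

/-- **The unimodular step**: for `g = (a b; c d) ∈ SL(2, ℤ)` with `c ≠ 0`, `d ≠ 0`,
`{∞, a/c}_G − {∞, b/d}_G = −{∞, 0}_{G|g}` — i.e. `{g0, g∞}_G = ∫_0^{i∞} (G ∣[2] g)`: apply §1 to `G`
at `g` and at `gS` (`gS∞ = g0 = b/d`) with base points `Sτ`, `τ`, and to `G ∣[2] g` at `S`.
[cite: Manin1972, §1.5–§1.6] -/
theorem raySymbol_sub_raySymbol_eq (g : SL(2, ℤ)) (hc : (g 1 0 : ℤ) ≠ 0) (hd : (g 1 1 : ℤ) ≠ 0) :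
    (2 * Real.pi * ∫ t in Ioi (0 : ℝ), G (ofComplex (((g 0 0 : ℤ) : ℂ) / ((g 1 0 : ℤ) : ℂ) + t * I))) -
      (2 * Real.pi * ∫ t in Ioi (0 : ℝ), G (ofComplex (((g 0 1 : ℤ) : ℂ) / ((g 1 1 : ℤ) : ℂ) + t * I))) =
      -(2 * Real.pi * ∫ t in Ioi (0 : ℝ), (⇑G ∣[(2 : ℤ)] g) (ofComplex ((0 : ℂ) + t * I))) := by
  -- `gS` has first column `(b, d)`
  set gS : SL(2, ℤ) := g * ModularGroup.S with hgS
  have hgS00 : (gS 0 0 : ℤ) = g 0 1 := by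
    simp [hgS, ModularGroup.S, Matrix.mul_apply, Fin.sum_univ_two]
  have hgS10 : (gS 1 0 : ℤ) = g 1 1 := by
    simp [hgS, ModularGroup.S, Matrix.mul_apply, Fin.sum_univ_two]
  have hS10 : (ModularGroup.S 1 0 : ℤ) ≠ 0 := by simp [ModularGroup.S]
  have hS00 : ((ModularGroup.S 0 0 : ℤ) : ℂ) / ((ModularGroup.S 1 0 : ℤ) : ℂ) = 0 := by
    simp [ModularGroup.S]
  obtain ⟨τ⟩ := (inferInstance : Nonempty ℍ)
  -- `{∞, g∞}_G` with base point `S • τ`, `{∞, gS∞}_G` with base point `τ`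
  have h1 := raySymbol_eq G g hc (ModularGroup.S • τ)
  have h2 := raySymbol_eq G gS (by rw [hgS10]; exact hd) τ
  rw [hgS00, hgS10] at h2
  -- `{∞, 0}_{G|g}` with base point `τ`
  have h3 := raySymbol_smul_infty ModularGroup.S (isCuspFunction_slash_gamma1 G g)
    (by rw [← SlashAction.slash_mul]; exact isCuspFunction_slash_gamma1 G (g * ModularGroup.S)) hS10 τ
  rw [hS00] at h3
  rw [h1, h2, h3, hgS, SlashAction.slash_mul, mul_smul]
  ring

end Gamma1

/-! ### §3 Manin's trick: the ray symbols of `G` lie in a finitely generated `ℤ`-module -/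

section Manin

variable {L : ℕ} [NeZero L] (G : CuspForm (Gamma1 L) 2)

/-- **MANIN'S TRICK for `S₂(Γ₁(L))`.** There is a finitely generated `ℤ`-submodule `Λ_G ⊆ ℂ` containing every
ray symbol `{∞, r}_G = 2π∫₀^∞ G(r + it) dt`, `r ∈ ℚ`: `Λ_G` is the `ℤ`-span of the unimodular symbols
`{∞, 0}_{G|g}`, `g ∈ SL(2, ℤ)`, which take finitely many values (`G ∣[2] γg = G ∣[2] g` for `γ ∈ Γ₁(L)`, a
subgroup of finite index), and `{∞, a/c}_G ∈ Λ_G` by strong induction on `c` along the Euclidean algorithm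
(`exists_unimodular_step`, the unimodular step of §2, and `ℤ`-periodicity for `c = 1`). No Manin–Drinfeld
theorem and no Hecke operator is used. [cite: Manin1972, §1.5–§1.6, Prop. 1.6] -/
theorem exists_fg_forall_raySymbol_mem :
    ∃ Λ : Submodule ℤ ℂ, Λ.FG ∧
      ∀ r : ℚ, (2 * Real.pi * ∫ t in Ioi (0 : ℝ), G (ofComplex ((r : ℂ) + t * I))) ∈ Λ := by
  classical
  -- the unimodular symbols
  set M : SL(2, ℤ) → ℂ := fun g ↦
    2 * Real.pi * ∫ t in Ioi (0 : ℝ), (⇑G ∣[(2 : ℤ)] g) (ofComplex ((0 : ℂ) + t * I)) with hM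
  have hMinv : ∀ (γ : SL(2, ℤ)), γ ∈ Gamma1 L → ∀ g, M (γ * g) = M g := fun γ hγ g ↦ by
    simp only [hM, slash_mul_of_mem G hγ g]
  -- finitely many values: `M` factors through the finite right-coset space
  have hfin : (Set.range M).Finite := by
    haveI : Finite (Quotient (QuotientGroup.rightRel (Gamma1 L))) :=
      Finite.of_equiv _ (QuotientGroup.quotientRightRelEquivQuotientLeftRel (Gamma1 L)).symm
    set Mq : Quotient (QuotientGroup.rightRel (Gamma1 L)) → ℂ :=
      Quotient.lift M (fun a b hab ↦ by
        have hab' := QuotientGroup.rightRel_apply.mp hab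
        have : a = (b * a⁻¹)⁻¹ * b := by group
        rw [this]
        exact hMinv _ (inv_mem hab') b) with hMq
    refine (Set.finite_range Mq).subset ?_
    rintro _ ⟨g, rfl⟩
    exact ⟨Quotient.mk _ g, rfl⟩
  refine ⟨Submodule.span ℤ (Set.range M), Submodule.fg_def.mpr ⟨_, hfin, rfl⟩, ?_⟩
  have hMmem : ∀ g, M g ∈ Submodule.span ℤ (Set.range M) := fun g ↦ Submodule.subset_span ⟨g, rfl⟩
  -- periodicity of the ray symbol
  have hper : ∀ (r : ℚ) (n : ℤ), (2 * Real.pi * ∫ t in Ioi (0 : ℝ), G (ofComplex (((r + n : ℚ) : ℂ) + t * I))) =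
      2 * Real.pi * ∫ t in Ioi (0 : ℝ), G (ofComplex ((r : ℂ) + t * I)) := by
    intro r n
    have hp := (isCuspFunction_one_gamma1 G).periodic.int_mul n
    congr 1
    refine setIntegral_congr_fun measurableSet_Ioi fun t _ ↦ ?_
    have := hp ((r : ℂ) + t * I)
    simp only [Function.comp_apply] at this
    rw [← this]
    push_cast
    ring_nf
  -- `{∞, 0}_G = M(1)`
  have h0 : (2 * Real.pi * ∫ t in Ioi (0 : ℝ), G (ofComplex (((0 : ℚ) : ℂ) + t * I))) = M 1 := by
    simp only [hM, SlashAction.slash_one, Rat.cast_zero]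
  -- strong induction on the denominator
  have key : ∀ (c : ℕ) (a : ℤ), 1 ≤ c → IsCoprime a (c : ℤ) →
      (2 * Real.pi * ∫ t in Ioi (0 : ℝ), G (ofComplex ((((a : ℚ) / (c : ℚ) : ℚ) : ℂ) + t * I))) ∈
        Submodule.span ℤ (Set.range M) := by
    intro c
    induction c using Nat.strong_induction_on with
    | _ c ih =>
      intro a hc hac
      rcases Nat.lt_or_ge c 2 with hc1 | hc2
      · have hc1' : c = 1 := by omega
        subst hc1'
        have : ((a : ℚ) / ((1 : ℕ) : ℚ) : ℚ) = (0 : ℚ) + (a : ℤ) := by push_cast; ring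
        rw [this, hper 0 a, h0]
        exact hMmem 1
      · obtain ⟨b, d, hd0, hdc, hdet⟩ := exists_unimodular_step hc2 hac
        have hbd : IsCoprime b (d : ℤ) := ⟨-(c : ℤ), a, by linear_combination hdet⟩
        have ih' := ih d hdc b hd0 hbd
        set g : SL(2, ℤ) := P1Q.sl2 a b c d hdet with hg
        have g00 : (g 0 0 : ℤ) = a := by simp [hg, P1Q.sl2, P1Q.mat2]
        have g01 : (g 0 1 : ℤ) = b := by simp [hg, P1Q.sl2, P1Q.mat2]
        have g10 : (g 1 0 : ℤ) = c := by simp [hg, P1Q.sl2, P1Q.mat2]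
        have g11 : (g 1 1 : ℤ) = d := by simp [hg, P1Q.sl2, P1Q.mat2]
        have hgc : (g 1 0 : ℤ) ≠ 0 := by rw [g10]; exact_mod_cast (by omega : c ≠ 0)
        have hgd : (g 1 1 : ℤ) ≠ 0 := by rw [g11]; exact_mod_cast hd0.ne'
        have hstep : (2 * Real.pi * ∫ t in Ioi (0 : ℝ), G (ofComplex (((g 0 0 : ℤ) : ℂ) / ((g 1 0 : ℤ) : ℂ) + t * I))) -
            (2 * Real.pi * ∫ t in Ioi (0 : ℝ), G (ofComplex (((g 0 1 : ℤ) : ℂ) / ((g 1 1 : ℤ) : ℂ) + t * I))) =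
            -M g := raySymbol_sub_raySymbol_eq G g hgc hgd
        rw [g00, g01, g10, g11] at hstep
        push_cast at hstep
        have hac' : ((((a : ℚ) / (c : ℚ) : ℚ) : ℂ)) = (a : ℂ) / (c : ℂ) := by push_cast; ring
        have hbd' : ((((b : ℚ) / (d : ℚ) : ℚ) : ℂ)) = (b : ℂ) / (d : ℂ) := by push_cast; ring
        rw [hbd'] at ih'
        rw [hac', sub_eq_iff_eq_add.mp hstep]
        exact Submodule.add_mem _ (Submodule.neg_mem _ (hMmem g)) ih'
  intro r
  have hcop : IsCoprime r.num (r.den : ℤ) := by rw [Int.isCoprime_iff_gcd_eq_one]; exact r.reduced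
  have hkey := key r.den r.num r.den_pos hcop
  rwa [Rat.num_div_den r] at hkey

end Manin

end Summit.BirchSwinnertonDyer.BirchSwinnertonDyer.Theorems.PSGamma1RaySymbol

end
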